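import Literature.MathematicalPhysics.QuantumFieldTheory.Balaban1983to89.B13Sect1Arith

/-!
# `Balaban1983to89.B13Eq117Hk` — T. Bałaban, *Renormalization group approach to lattice gauge field theories.
II. Cluster expansions*, Commun. Math. Phys. **116** (1988) 1–22 [Balaban1988RG2Cluster], (1.17) p. 6: the function
`H_k(s(Y₀), B′) = H₀(s(Y₀))B′ + A₀(s(Y₀), H₀(s(Y₀))B′) − H(s(Y₀))D(H(s(Y₀)), H₀(s(Y₀))B′ + A₀(s(Y₀), H₀(s(Y₀))B′))`
TYPED on the abstract complex-normed-space model of `B13Contraction113`/`B13Sect1Arith`, with the bounds (1.18) and (1.21)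
for the typed object as INSTANCES of the arithmetic already kernel-checked in `B13Sect1Arith` (used by name)

statement-level skeleton of published theorems with citation tags; proofs where landed; nothing here is a claim about the Yang–Mills mass gap

PDF held: `paper:balaban1988-cmp116-rg-ii-cluster` (journal page = PDF page).  Displays read on the ×2 page renders
`run/shared/lean/pub/pub-balaban/b2b-balaban-ref1/pages/1988-cmp116-rg-II-cluster/1988-cmp116-rg-II-cluster-p005-x2.png` …
`…-p007-x2.png` (pp. 5–7), as images (the publisher's text layer is garbled).

CITATION HEADER / WHAT IS REPRODUCED.  p. 6 [PDF 6], verbatim: *"This finally implies the desired result for the function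
H_k(s(Y₀), B′) = H₀(s(Y₀))B′ + A₀(s(Y₀), H₀(s(Y₀))B′) − H(s(Y₀))D(H(s(Y₀)), H₀(s(Y₀))′ + A₀(s(Y₀), H₀(s(Y₀))B′)). (1.17)
It is an analytic function of s(Y₀), B′, satisfying the bound |H_k(s(Y₀), B′)| ≦ 4B₀e^{16κ₁}|B′| < 4B₀e^{16κ₁}ε₃ ≦ 2ε₂, (1.18)
and the same bound for all admissible norms."* (print slip in (1.17): «H₀(s(Y₀))′» for «H₀(s(Y₀))B′» — the argument of `D`
is the field `H₀(s(Y₀))B′ + A₀(…)` of the line above; cell transcript `transcript-B13.md`, `B13Sect1Arith.bound_118`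
docstring *"[sic: B′ dropped in print]"*); p. 7 [PDF 7], verbatim: *"has the estimate |H_k(s(Y₀), B′)| ≦ 4B₀C₁e^{16κ₁}g_k|B| <
4B₀C₁e^{16κ₁}ε₁, (1.21) and the same for all admissible norms, if e^{32κ₁}ε₁ is smaller than an absolute constant. This
constant can be easily obtained by inspection of all the above conditions."*  INPUTS, all displayed hypotheses here exactly
as in `B13Sect1Arith` (whose Part A certifies the real arithmetic of (1.13)–(1.22) with `b` = the printed `B₀e^{16κ₁}`):
p. 5/6 *"they have the same bound (1.11) as H(s(Y₀)), hence their norms are bounded by B₀e^{16κ₁}"* (`‖H₀Y‖ ≤ b‖Y‖`,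
`‖HX‖ ≤ b‖X‖`); (1.14) p. 5 *"|D(H(s(Y₀)), A′)| ≦ 4C₂|A′|²"* on `|A′| < ε₂` (kernel: `B13Contraction113.bound_114`); (1.16)
p. 6 *"|A₀(s(Y₀), H₀(s(Y₀))B′)| ≦ 4C₄(B₀e^{16κ₁})³|B′|²"* on `|B′| < ε₃` (kernel: `B13Contraction113.fixedPoint_115` +
`B13Sect1Arith.chain_116`); the census restrictions R2 `4C₂bε₂ ≤ 1` (p. 5), R3 `4C₄b²ε₃ ≤ 1`, R4 `2bε₃ ≤ ε₂` (p. 6).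
THIS FILE (SKELETON row B13.Eq1.17, `absent (schematic)` at v3.12; MOST-VALUABLE-ABSENT protocol, owner r10): (1.17) AS A
DEFINITION over abstract complex normed spaces (`B′ ∈ 𝒴`, vector potentials `∈ 𝒜`, `D`-values `∈ 𝒳`; `H₀ : 𝒴 →ₗ[ℂ] 𝒜`,
`A₀ : 𝒜 → 𝒜` at fixed `s(Y₀)`, `H : 𝒳 →ₗ[ℂ] 𝒜`, `D : 𝒜 → 𝒳` = the solution of (1.3) at fixed `H(s(Y₀))`) — `Hk`, with the
inner field `xArg` = `H₀B′ + A₀(H₀B′)`; (1.18) for the typed object (`ineq118`: the object-level steps — triangle inequalities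
and the domain condition `‖H₀B′ + A₀(H₀B′)‖ < ε₂` — followed by `B13Sect1Arith.bound_118`/`tail_118` BY NAME; SKELETON row
B13.Eq1.18 stays `proved-existing` by that file); (1.21) for the typed object (`ineq121`, via `B13Sect1Arith.bound_121`, for
any `B′` obeying (1.20) `‖B′‖ ≤ C₁g_k|B|`, `g_k|B| < ε₁`, with the p. 7 inspection choice `C₁ε₁ ≤ ε₃` of
`B13Sect1Arith.inspection_121`; the printed `B′` of (1.19) is the sibling `…Balaban1983to89.B13Eq119BPrime`, seat p32,
whose `norm_bPrime_le` supplies exactly this hypothesis); and *«It is an analytic function of … B′»* for the typed object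
from analyticity of `A₀ ∘ H₀` and of `D` (displayed hypotheses; kernel for `D`: `B13Contraction113.analytic_fixedPoint_113`
along complex lines, `B12LinearizAnalytic267.analyticOnNhd_Dt` jointly) — `analyticOnNhd_Hk`.  MODEL / DIVERGENCE (cell
row D-pv20.5, as in `B13Sect1Arith`/`B13Contraction113`): abstract complex normed spaces and norms in place of the printed
lattice function spaces and *«all admissible norms»*; `s(Y₀)` fixed (suppressed); nothing of the series beyond the displayed
hypotheses is asserted; NOT summit progress.  Unit `lit-balaban-p32` (Phase-2 proof seat p32), HOME
`run/shared/lean/pub/lit-balaban/`.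
-/

noncomputable section

namespace Literature.MathematicalPhysics.QuantumFieldTheory.Balaban1983to89.B13Eq117Hk

open Metric Set

variable {𝒴 𝒜 𝒳 : Type*} [NormedAddCommGroup 𝒴] [NormedSpace ℂ 𝒴] [NormedAddCommGroup 𝒜] [NormedSpace ℂ 𝒜]
  [NormedAddCommGroup 𝒳] [NormedSpace ℂ 𝒳]

/-! ## §1. (1.17) typed -/

/-- The inner field of (1.17), `H₀(s(Y₀))B′ + A₀(s(Y₀), H₀(s(Y₀))B′)` — the argument of `D(H(s(Y₀)), ·)` (printed with the
slip «H₀(s(Y₀))′»). [cite: Balaban1988RG2Cluster, (1.17) p.6] -/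
def xArg (H0 : 𝒴 →ₗ[ℂ] 𝒜) (A0 : 𝒜 → 𝒜) (B' : 𝒴) : 𝒜 := H0 B' + A0 (H0 B')

/-- **(1.17) p. 6 [PDF 6]**, verbatim: *"H_k(s(Y₀), B′) = H₀(s(Y₀))B′ + A₀(s(Y₀), H₀(s(Y₀))B′) − H(s(Y₀))D(H(s(Y₀)),
H₀(s(Y₀))′ + A₀(s(Y₀), H₀(s(Y₀))B′)). (1.17)"* — typed reading, at fixed `s(Y₀)`: `H_k(B′) = x − H(D(x))`,
`x = H₀B′ + A₀(H₀B′)`, for linear `H₀ : 𝒴 →ₗ[ℂ] 𝒜`, `H : 𝒳 →ₗ[ℂ] 𝒜` (the propagators `H₀(s(Y₀))`, `H(s(Y₀))`), the fixed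
point `A₀(s(Y₀), ·) : 𝒜 → 𝒜` of (1.4) and the solution `D(H(s(Y₀)), ·) : 𝒜 → 𝒳` of (1.3).
[cite: Balaban1988RG2Cluster, (1.17) p.6] -/
def Hk (H0 : 𝒴 →ₗ[ℂ] 𝒜) (A0 : 𝒜 → 𝒜) (H : 𝒳 →ₗ[ℂ] 𝒜) (D : 𝒜 → 𝒳) (B' : 𝒴) : 𝒜 :=
  H0 B' + A0 (H0 B') - H (D (H0 B' + A0 (H0 B')))

/-- Unfolding (1.17). [cite: Balaban1988RG2Cluster, (1.17) p.6] -/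
theorem Hk_def (H0 : 𝒴 →ₗ[ℂ] 𝒜) (A0 : 𝒜 → 𝒜) (H : 𝒳 →ₗ[ℂ] 𝒜) (D : 𝒜 → 𝒳) (B' : 𝒴) :
    Hk H0 A0 H D B' = H0 B' + A0 (H0 B') - H (D (H0 B' + A0 (H0 B'))) := rfl

/-- (1.17) in the two-piece form `H_k(B′) = x − H(D(x))`, `x = xArg H₀ A₀ B′`. [cite: Balaban1988RG2Cluster, (1.17) p.6] -/
theorem Hk_eq_xArg (H0 : 𝒴 →ₗ[ℂ] 𝒜) (A0 : 𝒜 → 𝒜) (H : 𝒳 →ₗ[ℂ] 𝒜) (D : 𝒜 → 𝒳) (B' : 𝒴) :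
    Hk H0 A0 H D B' = xArg H0 A0 B' - H (D (xArg H0 A0 B')) := rfl

/-- (1.17) is the change of variables (1.12) p. 5, `A = A′ − H(s(Y₀))D(H(s(Y₀)), A′)`, evaluated at `A′ = H₀B′ + A₀(H₀B′)`.
[cite: Balaban1988RG2Cluster, (1.12) p.5] -/
theorem Hk_eq_changeOfVariables (H0 : 𝒴 →ₗ[ℂ] 𝒜) (A0 : 𝒜 → 𝒜) (H : 𝒳 →ₗ[ℂ] 𝒜) (D : 𝒜 → 𝒳) (B' : 𝒴) :
    Hk H0 A0 H D B' = (fun A' : 𝒜 => A' - H (D A')) (xArg H0 A0 B') := rfl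

/-! ## §2. (1.18) for the typed `H_k` -/

variable {H0 : 𝒴 →ₗ[ℂ] 𝒜} {A0 : 𝒜 → 𝒜} {H : 𝒳 →ₗ[ℂ] 𝒜} {D : 𝒜 → 𝒳} {b C₂ C₄ ε₂ ε₃ : ℝ}

/-- The inner field is small: under (1.16) and R3, `‖A₀(H₀B′)‖ ≤ b‖B′‖` and `‖H₀B′ + A₀(H₀B′)‖ ≤ 2b‖B′‖ < 2bε₃ ≤ ε₂`
(R4) for `|B′| < ε₃` — so the argument of `D` lies in the domain `|A′| < ε₂` of (1.14) (p. 6: *"the function satisfies the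
assumption of Proposition 4 in this case"* is the same bookkeeping one display earlier). [cite: Balaban1988RG2Cluster, (1.17) p.6] -/
theorem norm_xArg_lt (hb : 0 < b) (hC₄ : 0 ≤ C₄) (hH0 : ∀ Y, ‖H0 Y‖ ≤ b * ‖Y‖)
    (hA0 : ∀ Y : 𝒴, ‖Y‖ < ε₃ → ‖A0 (H0 Y)‖ ≤ 4 * C₄ * b ^ 3 * ‖Y‖ ^ 2)
    (hR3 : 4 * C₄ * b ^ 2 * ε₃ ≤ 1) (hR4 : 2 * b * ε₃ ≤ ε₂) {B' : 𝒴} (hB : ‖B'‖ < ε₃) :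
    ‖xArg H0 A0 B'‖ ≤ ‖H0 B'‖ + ‖A0 (H0 B')‖ ∧ ‖A0 (H0 B')‖ ≤ b * ‖B'‖ ∧ ‖xArg H0 A0 B'‖ < ε₂ := by
  have h1 : ‖H0 B'‖ ≤ b * ‖B'‖ := hH0 B'
  have h2 : ‖A0 (H0 B')‖ ≤ 4 * C₄ * b ^ 3 * ‖B'‖ ^ 2 := hA0 B' hB
  have hx : ‖xArg H0 A0 B'‖ ≤ ‖H0 B'‖ + ‖A0 (H0 B')‖ := norm_add_le _ _
  have hn : 0 ≤ ‖B'‖ := norm_nonneg _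
  have h2' : ‖A0 (H0 B')‖ ≤ b * ‖B'‖ := by
    have e : 4 * C₄ * b ^ 3 * ‖B'‖ ^ 2 = (b * ‖B'‖) * (4 * C₄ * b ^ 2 * ‖B'‖) := by ring
    have hs : 4 * C₄ * b ^ 2 * ‖B'‖ ≤ 1 :=
      (mul_le_mul_of_nonneg_left hB.le (by positivity)).trans hR3
    have hbn : 0 ≤ b * ‖B'‖ := by positivity
    nlinarith
  refine ⟨hx, h2', ?_⟩
  calc ‖xArg H0 A0 B'‖ ≤ ‖H0 B'‖ + ‖A0 (H0 B')‖ := hx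
    _ ≤ b * ‖B'‖ + b * ‖B'‖ := add_le_add h1 h2'
    _ = 2 * b * ‖B'‖ := by ring
    _ < 2 * b * ε₃ := by gcongr
    _ ≤ ε₂ := hR4

/-- **(1.18) p. 6 [PDF 6] for the typed `H_k`**, verbatim: *"satisfying the bound |H_k(s(Y₀), B′)| ≦ 4B₀e^{16κ₁}|B′| <
4B₀e^{16κ₁}ε₃ ≦ 2ε₂, (1.18)"* — from the DISPLAYED inputs `‖H₀Y‖ ≤ b‖Y‖`, `‖HX‖ ≤ b‖X‖` (p. 5/6, `b = B₀e^{16κ₁}`), (1.16)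
`‖A₀(H₀B′)‖ ≤ 4C₄b³‖B′‖²` on `|B′| < ε₃`, (1.14) `‖D(A′)‖ ≤ 4C₂‖A′‖²` on `|A′| < ε₂`, and R2–R4: the object-level steps are the
two triangle inequalities and the domain condition `norm_xArg_lt`; the arithmetic `n₁ + n₂ + n₃ ≤ 4b|B′|` IS
`B13Sect1Arith.bound_118` and the tail `< 4bε₃ ≤ 2ε₂` IS `B13Sect1Arith.tail_118` (by name, not re-derived).
[cite: Balaban1988RG2Cluster, (1.18) p.6] -/
theorem ineq118 (hb : 0 < b) (hC₂ : 0 ≤ C₂) (hC₄ : 0 ≤ C₄) (hH0 : ∀ Y, ‖H0 Y‖ ≤ b * ‖Y‖)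
    (hA0 : ∀ Y : 𝒴, ‖Y‖ < ε₃ → ‖A0 (H0 Y)‖ ≤ 4 * C₄ * b ^ 3 * ‖Y‖ ^ 2) (hH : ∀ X, ‖H X‖ ≤ b * ‖X‖)
    (hD : ∀ A' : 𝒜, ‖A'‖ < ε₂ → ‖D A'‖ ≤ 4 * C₂ * ‖A'‖ ^ 2)
    (hR2 : 4 * C₂ * b * ε₂ ≤ 1) (hR3 : 4 * C₄ * b ^ 2 * ε₃ ≤ 1) (hR4 : 2 * b * ε₃ ≤ ε₂) {B' : 𝒴} (hB : ‖B'‖ < ε₃) :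
    ‖Hk H0 A0 H D B'‖ ≤ 4 * b * ‖B'‖ ∧ 4 * b * ‖B'‖ < 4 * b * ε₃ ∧ 4 * b * ε₃ ≤ 2 * ε₂ := by
  obtain ⟨hx, -, hxε⟩ := norm_xArg_lt hb hC₄ hH0 hA0 hR3 hR4 hB
  have h3 : ‖H (D (xArg H0 A0 B'))‖ ≤ b * (4 * C₂ * ‖xArg H0 A0 B'‖ ^ 2) :=
    (hH _).trans (mul_le_mul_of_nonneg_left (hD _ hxε) hb.le)
  have hsum := B13Sect1Arith.bound_118 hC₂ hC₄ hb.le (norm_nonneg B') hB hR2 hR3 hR4 (hH0 B') (hA0 B' hB)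
    (norm_nonneg _) hx h3
  refine ⟨?_, B13Sect1Arith.tail_118 hb hB hR4⟩
  calc ‖Hk H0 A0 H D B'‖ = ‖xArg H0 A0 B' - H (D (xArg H0 A0 B'))‖ := rfl
    _ ≤ ‖xArg H0 A0 B'‖ + ‖H (D (xArg H0 A0 B'))‖ := norm_sub_le _ _
    _ ≤ ‖H0 B'‖ + ‖A0 (H0 B')‖ + ‖H (D (xArg H0 A0 B'))‖ := by gcongr
    _ ≤ 4 * b * ‖B'‖ := hsum

/-! ## §3. (1.21) for the typed `H_k` -/

/-- **(1.21) p. 7 [PDF 7] for the typed `H_k`**, verbatim: *"has the estimate |H_k(s(Y₀), B′)| ≦ 4B₀C₁e^{16κ₁}g_k|B| <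
4B₀C₁e^{16κ₁}ε₁, (1.21) and the same for all admissible norms, if e^{32κ₁}ε₁ is smaller than an absolute constant."* — for any
`B′` obeying (1.20), `‖B′‖ ≤ C₁·g_k|B|` with `g_k|B| < ε₁` (the printed `B′ = g_kCB − hD̃(g_kCB)` of (1.19) does:
`B13Eq119BPrime.norm_bPrime_le`), under the p. 7 inspection choice `C₁ε₁ ≤ ε₃` (`B13Sect1Arith.inspection_121`: with
`ε₃ := C₁ε₁`, `ε₂ := 2bε₃` the restrictions R2–R4 hold when `e^{32κ₁}ε₁` is small): (1.18) then (1.21) =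
`B13Sect1Arith.bound_121` by name. [cite: Balaban1988RG2Cluster, (1.21) p.7] -/
theorem ineq121 (hb : 0 < b) (hC₂ : 0 ≤ C₂) (hC₄ : 0 ≤ C₄) (hH0 : ∀ Y, ‖H0 Y‖ ≤ b * ‖Y‖)
    (hA0 : ∀ Y : 𝒴, ‖Y‖ < ε₃ → ‖A0 (H0 Y)‖ ≤ 4 * C₄ * b ^ 3 * ‖Y‖ ^ 2) (hH : ∀ X, ‖H X‖ ≤ b * ‖X‖)
    (hD : ∀ A' : 𝒜, ‖A'‖ < ε₂ → ‖D A'‖ ≤ 4 * C₂ * ‖A'‖ ^ 2)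
    (hR2 : 4 * C₂ * b * ε₂ ≤ 1) (hR3 : 4 * C₄ * b ^ 2 * ε₃ ≤ 1) (hR4 : 2 * b * ε₃ ≤ ε₂)
    {C₁ a ε₁ : ℝ} (hC₁ : 0 < C₁) (hε : C₁ * ε₁ ≤ ε₃) {B' : 𝒴} (h20 : ‖B'‖ ≤ C₁ * a) (ha : a < ε₁) :
    ‖Hk H0 A0 H D B'‖ ≤ 4 * b * C₁ * a ∧ 4 * b * C₁ * a < 4 * b * C₁ * ε₁ := by
  have hB : ‖B'‖ < ε₃ := by
    calc ‖B'‖ ≤ C₁ * a := h20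
      _ < C₁ * ε₁ := by gcongr
      _ ≤ ε₃ := hε
  have h18 := (ineq118 hb hC₂ hC₄ hH0 hA0 hH hD hR2 hR3 hR4 hB).1
  exact B13Sect1Arith.bound_121 hb hC₁ h18 h20 ha

/-! ## §4. *«It is an analytic function of s(Y₀), B′»* for the typed `H_k` (in `B′`, at fixed `s(Y₀)`) -/

/-- `H₀` maps the ball `‖B′‖ < ε₃` into `‖·‖ < bε₃` and the inner field stays in the domain `‖A′‖ < ε₂` of `D`.
[cite: Balaban1988RG2Cluster, (1.17) p.6] -/
theorem mapsTo_xArg (hb : 0 < b) (hC₄ : 0 ≤ C₄) (hH0 : ∀ Y, ‖H0 Y‖ ≤ b * ‖Y‖)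
    (hA0 : ∀ Y : 𝒴, ‖Y‖ < ε₃ → ‖A0 (H0 Y)‖ ≤ 4 * C₄ * b ^ 3 * ‖Y‖ ^ 2)
    (hR3 : 4 * C₄ * b ^ 2 * ε₃ ≤ 1) (hR4 : 2 * b * ε₃ ≤ ε₂) :
    MapsTo (xArg H0 A0) (ball (0 : 𝒴) ε₃) (ball (0 : 𝒜) ε₂) := fun B' hB => by
  rw [mem_ball_zero_iff] at hB ⊢
  exact (norm_xArg_lt hb hC₄ hH0 hA0 hR3 hR4 hB).2.2

/-- **`H_k` is analytic in `B′`** on `‖B′‖ < ε₃`, from the DISPLAYED analyticity of `B′ ↦ A₀(s(Y₀), H₀(s(Y₀))B′)` there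
((1.16): *"the fixed point … is an analytic function of B′, s(Y₀)"*) and of `D(H(s(Y₀)), ·)` on `‖A′‖ < ε₂` ((1.14): *"the
fixed point is an analytic function of A′, s(Y₀)"*; kernels `B13Contraction113.analytic_fixedPoint_113`,
`B12LinearizAnalytic267.analyticOnNhd_Dt`), with `H₀`, `H` bounded linear. [cite: Balaban1988RG2Cluster, (1.18) p.6] -/
theorem analyticOnNhd_Hk (hb : 0 < b) (hC₄ : 0 ≤ C₄) (hH0 : ∀ Y, ‖H0 Y‖ ≤ b * ‖Y‖)
    (hA0 : ∀ Y : 𝒴, ‖Y‖ < ε₃ → ‖A0 (H0 Y)‖ ≤ 4 * C₄ * b ^ 3 * ‖Y‖ ^ 2) (hH : ∀ X, ‖H X‖ ≤ b * ‖X‖)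
    (hR3 : 4 * C₄ * b ^ 2 * ε₃ ≤ 1) (hR4 : 2 * b * ε₃ ≤ ε₂)
    (hA0a : AnalyticOnNhd ℂ (fun Y : 𝒴 => A0 (H0 Y)) (ball (0 : 𝒴) ε₃))
    (hDa : AnalyticOnNhd ℂ D (ball (0 : 𝒜) ε₂)) :
    AnalyticOnNhd ℂ (Hk H0 A0 H D) (ball (0 : 𝒴) ε₃) := by
  let L0 : 𝒴 →L[ℂ] 𝒜 := H0.mkContinuous b hH0
  let L : 𝒳 →L[ℂ] 𝒜 := H.mkContinuous b hH
  have hx : AnalyticOnNhd ℂ (xArg H0 A0) (ball (0 : 𝒴) ε₃) := by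
    intro Y hY
    have h : AnalyticAt ℂ (fun Y : 𝒴 => L0 Y + A0 (H0 Y)) Y := (L0.analyticAt Y).add (hA0a Y hY)
    exact h
  have hDx : AnalyticOnNhd ℂ (fun Y : 𝒴 => D (xArg H0 A0 Y)) (ball (0 : 𝒴) ε₃) :=
    hDa.comp hx (mapsTo_xArg hb hC₄ hH0 hA0 hR3 hR4)
  intro Y hY
  have h : AnalyticAt ℂ (fun Y : 𝒴 => xArg H0 A0 Y - L (D (xArg H0 A0 Y))) Y :=
    (hx Y hY).sub ((L.analyticAt _).comp (hDx Y hY))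
  exact h

end Literature.MathematicalPhysics.QuantumFieldTheory.Balaban1983to89.B13Eq117Hk

end
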